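import Literature.NumberTheory.GaloisRepresentations.LubinTate
import Literature.NumberTheory.EllipticCurves.FormalGroupFrobeniusTypeAllPrimesProofs
import Literature.NumberTheory.EllipticCurves.FormalGroupMultiplicationUniversalProofs
import Literature.NumberTheory.EllipticCurves.FormalGroupLawAxiomsUniversalProofs
import Literature.NumberTheory.EllipticCurves.FormalGroupFiniteHeightProofs
import Literature.NumberTheory.EllipticCurves.PadicPointsFiltration
import HarnessLib

/-!
# The formal group of a supersingular model with `a_p = 0` is RELATIVE LUBIN–TATE for `(π, q) = (−p, p²)`, I:
# the series `f_V = i([p] X)` — `f_V ≡ −pX (mod deg 2)`, `f_V ∈ End(F_V)`, and `f_V ≡ X^{p²} (mod p)`;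
# `ℤ_p` (and every local `ℤ_p`-algebra with `a^{p²} ≡ a`, e.g. `ℤ₄ = W(𝔽₄)` at `p = 2`) is a Lubin–Tate base for `(−p, p²)`
# (Kobayashi 2003, Prop. 8.6, at every prime; kernel)

Route `ResidualThetaTransportAtTwo` (RTT), rank-2 crux `ResidualThetaCountLowerAtTwo` (stmt-BirchSwinnertonDyer-25435) / the
premise-free (R≥) of `Cruxes/ResidualThetaCountAtTwo/RGE-RESTATEMENT-g8.md`; seat `prover-bsd-wall-rtt-p2` g9 (`--supports`, closes
nothing). Sequel: `…RelativeLubinTateModule` (the formal `A`-module structure `[a]_V`, `a ∈ A`, and the comparison of two models).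
HONEST FRAMING: THEOREMS ONLY (no definition, no named fact, no instance, no `sorry`); route-independent (no `Theses` import);
pure formal-group algebra; nothing about any Selmer group; BSD is not proved by any of this.

WHY (memos `Cruxes/ResidualThetaMainConjectureAtTwo/RMC-ROADS-g6.md` §2 ROAD B (B1)/(B3)/(UQ2), `RMC-LOCAL2-g7.md` §2). Every CM
transport of Kobayashi's `+` condition at the prime `2` for a habitat curve `W` (`GoodSS W 2`, `a₂(W) = 0`, tier 2: `K = ℚ(√Δ_W)` of
any class number, `2` inert) passes through the unramified quadratic base `ℤ₄ = W(𝔽₄) = 𝒪_{K_2}` and needs `Ŵ ⊗ ℤ₄` to be a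
formal `ℤ₄`-module isomorphic to the CM partner's Lubin–Tate group `LT(ℚ₄, −2)` (g7 §2 READING «`Ŵ ⊗ ℤ₄ ≅ LT(ℚ₄, −2) ≅ B̂_w`»;
the (UQ2) descent along `ℚ₄ℚ_{2,n}/ℚ_{2,n}`; the `𝔽₄`-structure of `R⁺_{S₀}(W[2])` over `K_∞`). The tree's Honda port
(`RingTheory/FormalGroups/HondaTypeTransport`) is `σ = id` over `ℤ_p` and cannot see `ℤ₄`; the tree's ABSTRACT Lubin–Tate
theory (`GaloisRepresentations/LubinTate`: any base `IsLTRing π q A`, any `q = p^r`, uniqueness in Lubin–Tate's lemma) can —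
once `[−p]_V(X) ≡ X^{p²} (mod p)` is known. That congruence is Manin's `φ² − a_pφ + p = 0` on the formal point of
`Ẽ(𝔽_p⸨X⸩)` (tree `frob_relation_laurentPt`, every `p`) at `a_p = 0`, and this file makes it the Lubin–Tate membership
`f_V ∈ 𝔉_{−p}` for the exponent `q = p²` of the RELATIVE theory (de Shalit I §1.1: `q` need not be `#(A/π)`).

WHAT (every prime `p`; `V/ℤ_p` a Weierstrass equation; `f_V := V.formalNeg.subst (V.formalMul p) = i_V([p]_V X)`):
* §1 (any `ℚ`-algebra domain, no ellipticity) `subst_formalGroupLaw_eq_of_formalLog_subst` — `θ ∈ XA⟦X⟧` with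
  `log_V ∘ θ = c·log_V` is an endomorphism of `F_V`; two such commute (`subst_comm_of_formalLog_subst`);
  `formalLog_subst_formalNeg_subst_formalMul` (`log ∘ [−n] = −n·log`) and the instances for `[−n]`, `[m]`.
* §2 (`ℤ_p`, by descent from `ℚ_p`) `coeff_one_formalNeg_subst_formalMul` (`f_V ≡ −pX`),
  **`formalNeg_subst_formalMul_subst_formalGroupLaw`** (`f_V ∘ F_V = F_V ∘ (f_V × f_V)`),
  `formalMul_subst_formalNeg_subst_formalMul` (`[m] ∘ f_V = f_V ∘ [m]`), `coeff_single_formalGroupLaw` (`F_V ≡ X + Y`); for elliptic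
  fibres with `tr(V mod p) = 0`: **`map_toZMod_formalNeg_subst_formalMul : f_V ≡ X^{p²} (mod p)`**, hence
  **`isLTSeries_formalNeg_subst_formalMul : IsLTSeries (−p) (p²) f_V`**; `isLTRing_padicInt : IsLTRing (−p) (p²)` for `ℤ_p`.
* §2b `isLTSeries_map` (base change of Lubin–Tate series), **`isLTRing_of_isLocalRing`**: every local ring `A` with `p ∈ 𝔪_A`
  regular and `a^{p²} ≡ a (mod p)` is a Lubin–Tate base for `(−p, p²)` — e.g. `W(𝔽_{p²})`, any `𝒪_K` with residue degree `∣ 2`.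

References: [Kobayashi2003] S. Kobayashi, Invent. Math. 152 (2003), Cor. 8.5, Prop. 8.6 and its proof (p. 15: «over the integer ring
of the unramified quadratic extension of ℚ_p, 𝔽_ss is isomorphic to the Lubin–Tate formal group of height two with the parameter −p»;
«[−p]X ≡ X^{p²} mod p»); [LubinTate1965] J. Lubin, J. Tate, Ann. of Math. 81 (1965), §1; [deShalit1987] E. de Shalit, *Iwasawa theory
of elliptic curves with complex multiplication*, Ch. I §1.1–1.3 (relative Lubin–Tate groups); [SilvermanAEC2009] IV.2–IV.5, V.2.3.1(b);
[CasselsFrohlichANT1967] Ch. VI §3.5 Remark 2.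
-/

set_option autoImplicit false
-- the Theorems namespace of this sub repeats the summit name by design (D-0017 nested layout)
set_option linter.dupNamespace false

noncomputable section

open scoped Classical
open PowerSeries WeierstrassCurve Literature.NumberTheory.EllipticCurves
  Literature.NumberTheory.GaloisRepresentations

namespace Summit.BirchSwinnertonDyer.BirchSwinnertonDyer.Theorems.RelativeLubinTate

/-! ## §1 Over a `ℚ`-algebra domain: series with `log ∘ θ = c • log` are commuting endomorphisms -/

section RatDomain

variable {A : Type*} [CommRing A] [Algebra ℚ A] [IsDomain A] (V : WeierstrassCurve A)

/-- **A series `θ ∈ XA⟦X⟧` with `log_V(θ) = c · log_V` is an endomorphism of the formal group**: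
`θ(F_V(X, Y)) = F_V(θ X, θ Y)` (both sides have logarithm `c·(log X + log Y)`; cancel `log_V`).
[cite: SilvermanAEC2009, IV.5.2] -/
theorem subst_formalGroupLaw_eq_of_formalLog_subst {θ : A⟦X⟧} (hθ0 : constantCoeff θ = 0) {c : A}
    (hθ : V.formalLog.subst θ = c • V.formalLog) :
    θ.subst V.formalGroupLaw =
      MvPowerSeries.subst (fun i : Fin 2 ↦ θ.subst (MvPowerSeries.X i : MvPowerSeries (Fin 2) A))
        V.formalGroupLaw := by
  set l := V.formalLog with hl
  set b : Fin 2 → MvPowerSeries (Fin 2) A :=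
    fun i ↦ θ.subst (MvPowerSeries.X i : MvPowerSeries (Fin 2) A) with hb
  have hθs : HasSubst θ := HasSubst.of_constantCoeff_zero' hθ0
  have hF : HasSubst V.formalGroupLaw := HasSubst.of_constantCoeff_zero V.constantCoeff_formalGroupLaw
  have hb0 : ∀ i, MvPowerSeries.constantCoeff (b i) = 0 := fun i ↦
    constantCoeff_subst_eq_zero (MvPowerSeries.constantCoeff_X i) θ hθ0
  have hbs : MvPowerSeries.HasSubst b := MvPowerSeries.hasSubst_of_constantCoeff_zero hb0
  have hL0 : MvPowerSeries.constantCoeff (θ.subst V.formalGroupLaw) = 0 :=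
    constantCoeff_subst_eq_zero V.constantCoeff_formalGroupLaw θ hθ0
  have hR0 : MvPowerSeries.constantCoeff (MvPowerSeries.subst b V.formalGroupLaw) = 0 :=
    MvPowerSeries.constantCoeff_subst_eq_zero hbs hb0 V.constantCoeff_formalGroupLaw
  refine V.eq_of_formalLog_subst_eq hL0 hR0 ?_
  have h1 : l.subst (θ.subst V.formalGroupLaw) =
      c • (l.subst (MvPowerSeries.X 0 : MvPowerSeries (Fin 2) A) +
        l.subst (MvPowerSeries.X 1 : MvPowerSeries (Fin 2) A)) := by
    rw [← subst_comp_subst_apply hθs hF, hl, hθ, subst_smul hF, V.formalLog_subst_formalGroupLaw]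
  have h2 : l.subst (MvPowerSeries.subst b V.formalGroupLaw) =
      c • (l.subst (MvPowerSeries.X 0 : MvPowerSeries (Fin 2) A) +
        l.subst (MvPowerSeries.X 1 : MvPowerSeries (Fin 2) A)) := by
    have hbi : ∀ i : Fin 2,
        MvPowerSeries.subst b (l.subst (MvPowerSeries.X i : MvPowerSeries (Fin 2) A)) =
          c • l.subst (MvPowerSeries.X i : MvPowerSeries (Fin 2) A) := fun i ↦ by
      rw [mvSubst_powerSeries_subst (HasSubst.X i) hbs, MvPowerSeries.subst_X hbs, hb]
      change l.subst (θ.subst (MvPowerSeries.X i)) = _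
      rw [← subst_comp_subst_apply hθs (HasSubst.X i), hl, hθ, subst_smul (HasSubst.X i)]
    rw [← mvSubst_powerSeries_subst hF hbs, hl, V.formalLog_subst_formalGroupLaw,
      MvPowerSeries.subst_add hbs, ← hl, hbi 0, hbi 1, smul_add]
  rw [h1, h2]

omit [IsDomain A] in
/-- **Two series with `log_V(θᵢ) = cᵢ · log_V` commute**: `θ₁(θ₂) = θ₂(θ₁)` (both have logarithm `c₁c₂·log_V`).
[cite: SilvermanAEC2009, IV.5.2] -/
theorem subst_comm_of_formalLog_subst {θ₁ θ₂ : A⟦X⟧} (h₁0 : constantCoeff θ₁ = 0)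
    (h₂0 : constantCoeff θ₂ = 0) {c₁ c₂ : A} (h₁ : V.formalLog.subst θ₁ = c₁ • V.formalLog)
    (h₂ : V.formalLog.subst θ₂ = c₂ • V.formalLog) : θ₁.subst θ₂ = θ₂.subst θ₁ := by
  have h₁s : HasSubst θ₁ := HasSubst.of_constantCoeff_zero' h₁0
  have h₂s : HasSubst θ₂ := HasSubst.of_constantCoeff_zero' h₂0
  refine V.eq_of_formalLog_subst_eq (constantCoeff_subst_eq_zero h₂0 θ₁ h₁0)
    (constantCoeff_subst_eq_zero h₁0 θ₂ h₂0) ?_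
  rw [← subst_comp_subst_apply h₁s h₂s, h₁, subst_smul h₂s, h₂, ← subst_comp_subst_apply h₂s h₁s, h₂,
    subst_smul h₁s, h₁, smul_smul, smul_smul, mul_comm]

/-- **`log_V ∘ [−n] = −n · log_V`** for `[−n] := i_V ∘ [n]_V = V.formalNeg.subst (V.formalMul n)` (`log ∘ i = −log`,
`log ∘ [n] = n·log`). [cite: SilvermanAEC2009, IV.5.2, IV.2.3] -/
theorem formalLog_subst_formalNeg_subst_formalMul (n : ℕ) :
    V.formalLog.subst (V.formalNeg.subst (V.formalMul n)) = (-(n : A)) • V.formalLog := by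
  have his : HasSubst V.formalNeg := HasSubst.of_constantCoeff_zero' V.constantCoeff_formalNeg
  have hns : HasSubst (V.formalMul n) := HasSubst.of_constantCoeff_zero' (V.constantCoeff_formalMul n)
  rw [← subst_comp_subst_apply his hns, V.formalLog_subst_formalNeg, ← coe_substAlgHom hns, map_neg,
    coe_substAlgHom hns]
  change -(V.formalLog.subst (V.formalMul n)) = _
  rw [V.formalLog_subst_formalMul_rat, neg_smul, Nat.cast_smul_eq_nsmul]

/-- `log_V ∘ [n] = n · log_V` with an `A`-scalar. [cite: SilvermanAEC2009, IV.5.2] -/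
theorem formalLog_subst_formalMul_smul (n : ℕ) :
    V.formalLog.subst (V.formalMul n) = (n : A) • V.formalLog := by
  rw [V.formalLog_subst_formalMul_rat, Nat.cast_smul_eq_nsmul]

/-- `[−n]` is an endomorphism of `F_V` over a `ℚ`-algebra domain. [cite: SilvermanAEC2009, IV.2.3] -/
theorem formalNeg_subst_formalMul_subst_formalGroupLaw_rat (n : ℕ) :
    PowerSeries.subst V.formalGroupLaw (V.formalNeg.subst (V.formalMul n)) =
      MvPowerSeries.subst (fun i : Fin 2 ↦ PowerSeries.subst (MvPowerSeries.X i : MvPowerSeries (Fin 2) A)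
        (V.formalNeg.subst (V.formalMul n))) V.formalGroupLaw :=
  subst_formalGroupLaw_eq_of_formalLog_subst V
    (constantCoeff_subst_eq_zero (V.constantCoeff_formalMul n) _ V.constantCoeff_formalNeg)
    (formalLog_subst_formalNeg_subst_formalMul V n)

/-- `[m]` commutes with `[−n]` over a `ℚ`-algebra domain. [cite: SilvermanAEC2009, IV.2.3] -/
theorem formalMul_subst_formalNeg_subst_formalMul_rat (m n : ℕ) :
    (V.formalMul m).subst (V.formalNeg.subst (V.formalMul n)) =
      PowerSeries.subst (V.formalMul m) (V.formalNeg.subst (V.formalMul n)) :=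
  subst_comm_of_formalLog_subst V (V.constantCoeff_formalMul m)
    (constantCoeff_subst_eq_zero (V.constantCoeff_formalMul n) _ V.constantCoeff_formalNeg)
    (formalLog_subst_formalMul_smul V m) (formalLog_subst_formalNeg_subst_formalMul V n)

end RatDomain

/-! ## §2 Over `ℤ_p`: `f_V = i([p] X) ≡ −pX (mod deg 2)`, `f_V ∈ End(F_V)`, and `f_V ≡ X^{p²} (mod p)` -/

section PadicInt

variable {p : ℕ} [hp : Fact p.Prime] (V : WeierstrassCurve ℤ_[p])

/-- `f_V = i_V([p]_V X)` has no constant term. [folklore] -/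
theorem constantCoeff_formalNeg_subst_formalMul (n : ℕ) :
    constantCoeff (V.formalNeg.subst (V.formalMul n)) = 0 :=
  constantCoeff_subst_eq_zero (V.constantCoeff_formalMul n) _ V.constantCoeff_formalNeg

/-- **`f_V ≡ −pX (mod deg 2)`**: the linear coefficient of `i_V([n]_V X)` is `−n`.
[cite: SilvermanAEC2009, IV.2.3] -/
theorem coeff_one_formalNeg_subst_formalMul (n : ℕ) :
    coeff 1 (V.formalNeg.subst (V.formalMul n)) = -(n : ℤ_[p]) := by
  rw [coeff_one_subst_eq_mul _ (V.constantCoeff_formalMul n), coeff_one_formalNeg, V.coeff_one_formalMul',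
    neg_one_mul]

/-- `map ℤ_p → ℚ_p` of `i_V([n] X)` is the same series for `V ⊗ ℚ_p`. [folklore] -/
theorem map_coe_formalNeg_subst_formalMul (n : ℕ) :
    PowerSeries.map (PadicInt.Coe.ringHom (p := p)) (V.formalNeg.subst (V.formalMul n)) =
      (V.map PadicInt.Coe.ringHom).formalNeg.subst ((V.map PadicInt.Coe.ringHom).formalMul n) := by
  rw [powerSeries_map_subst _ (HasSubst.of_constantCoeff_zero' (V.constantCoeff_formalMul n)), map_formalNeg,
    map_formalMul]

/-- Base change of `i_V([n] X)` along any ring map. [folklore] -/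
theorem map_formalNeg_subst_formalMul {S : Type*} [CommRing S] (φ : ℤ_[p] →+* S) (n : ℕ) :
    PowerSeries.map φ (V.formalNeg.subst (V.formalMul n)) = (V.map φ).formalNeg.subst ((V.map φ).formalMul n) := by
  rw [powerSeries_map_subst _ (HasSubst.of_constantCoeff_zero' (V.constantCoeff_formalMul n)), map_formalNeg,
    map_formalMul]

/-- **`f_V = [−p]` (indeed every `[−n]`) is an endomorphism of `F_V` over `ℤ_p`**: `f_V(F_V(X, Y)) = F_V(f_V X, f_V Y)`
(the `ℚ_p` identity descended along `ℤ_p⟦X,Y⟧ ↪ ℚ_p⟦X,Y⟧`). In Lubin–Tate's notation: `compLeft f_V F_V = compRight f_V F_V`.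
[cite: SilvermanAEC2009, IV.2.3] [cite: LubinTate1965, §1 (4)] -/
theorem formalNeg_subst_formalMul_subst_formalGroupLaw (n : ℕ) :
    PowerSeries.subst V.formalGroupLaw (V.formalNeg.subst (V.formalMul n)) =
      MvPowerSeries.subst (fun i : Fin 2 ↦ PowerSeries.subst (MvPowerSeries.X i : MvPowerSeries (Fin 2) ℤ_[p])
        (V.formalNeg.subst (V.formalMul n))) V.formalGroupLaw := by
  set φ := PadicInt.Coe.ringHom (p := p) with hφ
  set θ : ℤ_[p]⟦X⟧ := V.formalNeg.subst (V.formalMul n) with hθ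
  have hθ0 : constantCoeff θ = 0 := constantCoeff_formalNeg_subst_formalMul V n
  have hF : HasSubst V.formalGroupLaw := HasSubst.of_constantCoeff_zero V.constantCoeff_formalGroupLaw
  have hb0 : ∀ i : Fin 2, MvPowerSeries.constantCoeff
      (PowerSeries.subst (MvPowerSeries.X i : MvPowerSeries (Fin 2) ℤ_[p]) θ) = 0 :=
    fun i ↦ constantCoeff_subst_eq_zero (MvPowerSeries.constantCoeff_X i) _ hθ0
  have hbs : MvPowerSeries.HasSubst
      (fun i : Fin 2 ↦ PowerSeries.subst (MvPowerSeries.X i : MvPowerSeries (Fin 2) ℤ_[p]) θ) :=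
    MvPowerSeries.hasSubst_of_constantCoeff_zero hb0
  apply WeierstrassCurve.mvPowerSeries_map_injective (φ := φ) (fun x y h ↦ Subtype.val_injective h)
  rw [map_subst hF, map_formalGroupLaw, MvPowerSeries.map_subst hbs, map_formalGroupLaw]
  have hb : (fun i : Fin 2 ↦ MvPowerSeries.map φ
      (PowerSeries.subst (MvPowerSeries.X i : MvPowerSeries (Fin 2) ℤ_[p]) θ)) =
      fun i : Fin 2 ↦ PowerSeries.subst (MvPowerSeries.X i : MvPowerSeries (Fin 2) ℚ_[p]) (PowerSeries.map φ θ) := by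
    funext i
    rw [map_subst (HasSubst.X i), MvPowerSeries.map_X]
  rw [hb, hθ, map_coe_formalNeg_subst_formalMul V n]
  exact formalNeg_subst_formalMul_subst_formalGroupLaw_rat (V.map φ) n

/-- **`[m] ∘ [−n] = [−n] ∘ [m]` over `ℤ_p`** (in particular the multiplication maps `[m]_V` commute with `f_V`).
[cite: SilvermanAEC2009, IV.2.3] -/
theorem formalMul_subst_formalNeg_subst_formalMul (m n : ℕ) :
    (V.formalMul m).subst (V.formalNeg.subst (V.formalMul n)) =
      PowerSeries.subst (V.formalMul m) (V.formalNeg.subst (V.formalMul n)) := by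
  -- `ℤ_p⟦X⟧ ↪ ℚ_p⟦X⟧` (`PowerSeries.map = MvPowerSeries.map`; tree `HondaFss.map_injective` is the same fact)
  apply WeierstrassCurve.mvPowerSeries_map_injective (σ := Unit) (φ := PadicInt.Coe.ringHom (p := p))
    (fun x y h ↦ Subtype.val_injective h)
  change PowerSeries.map _ _ = PowerSeries.map _ _
  rw [powerSeries_map_subst _ (HasSubst.of_constantCoeff_zero' (constantCoeff_formalNeg_subst_formalMul V n)),
    powerSeries_map_subst _ (HasSubst.of_constantCoeff_zero' (V.constantCoeff_formalMul m)),
    map_coe_formalNeg_subst_formalMul, map_formalMul]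
  exact formalMul_subst_formalNeg_subst_formalMul_rat (V.map PadicInt.Coe.ringHom) m n

variable [hE : (V.map PadicInt.Coe.ringHom).IsElliptic]

/-- The linear coefficients of `F_V` are `1` (read off over `ℚ_p`). [cite: SilvermanAEC2009, IV.2.1] -/
theorem coeff_single_formalGroupLaw (i : Fin 2) :
    MvPowerSeries.coeff (Finsupp.single i 1) V.formalGroupLaw = 1 := by
  haveI : (V.map PadicInt.Coe.ringHom).IsIntegral ℤ_[p] := V.isIntegral_map_coe
  have h := congrArg (MvPowerSeries.coeff (Finsupp.single i 1)) (V.map_formalGroupLaw (PadicInt.Coe.ringHom (p := p)))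
  rw [MvPowerSeries.coeff_map] at h
  apply Subtype.val_injective
  change PadicInt.Coe.ringHom _ = ((1 : ℤ_[p]) : ℚ_[p])
  rw [h]
  fin_cases i
  · exact (V.map PadicInt.Coe.ringHom).coeff_single_zero_formalGroupLaw
  · exact (V.map PadicInt.Coe.ringHom).coeff_single_one_formalGroupLaw

variable [hEt : (V.map PadicInt.toZMod).IsElliptic]

/-- **`f_V ≡ X^{p²} (mod p)` when `tr(V mod p) = 0`**: in `𝔽_p⟦X⟧`, `ĩ([p]˜(X)) = X^{p²}`. Manin's relation
`φ² − aφ + p = 0` on the formal point `P(X) ∈ Ẽ(𝔽_p⸨X⸩)` (tree `frob_relation_laurentPt`) with `a = 0` reads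
`P(X^{p²}) = −p·P(X) = P(ĩ([p]˜ X))`, and `σ ↦ P(σ)` is injective. This is the congruence «`[−p]X ≡ X^{p²} mod p`» of
Kobayashi's proof of Prop. 8.6, valid in EVERY formal parameter. [cite: Kobayashi2003, Prop. 8.6 (proof)]
[cite: SilvermanAEC2009, Thm. V.2.3.1(b)] -/
theorem map_toZMod_formalNeg_subst_formalMul
    (htr : Literature.NumberTheory.EllipticCurves.HasseManin.tr (V.map PadicInt.toZMod) = 0) :
    PowerSeries.map PadicInt.toZMod (V.formalNeg.subst (V.formalMul p)) = (PowerSeries.X : (ZMod p)⟦X⟧) ^ p ^ 2 := by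
  rw [map_formalNeg_subst_formalMul V PadicInt.toZMod p]
  have hp0 : p ≠ 0 := hp.out.ne_zero
  have hX : constantCoeff (PowerSeries.X : (ZMod p)⟦X⟧) = 0 := PowerSeries.constantCoeff_X
  have hXp2 : constantCoeff ((PowerSeries.X : (ZMod p)⟦X⟧) ^ p ^ 2) = 0 :=
    constantCoeff_pow_prime hX (pow_ne_zero 2 hp0)
  have hn0 : constantCoeff ((V.map PadicInt.toZMod).formalMul p) = 0 :=
    (V.map PadicInt.toZMod).constantCoeff_formalMul p
  have hin0 : constantCoeff ((V.map PadicInt.toZMod).formalNeg.subst ((V.map PadicInt.toZMod).formalMul p)) = 0 :=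
    constantCoeff_subst_eq_zero hn0 _ (V.map PadicInt.toZMod).constantCoeff_formalNeg
  -- Manin's relation with `a = 0`: `P(X^{p²}) + p • P(X) = 0`
  have hrel := (V.map PadicInt.toZMod).frob_relation_laurentPt
  rw [htr, zero_zsmul, sub_zero] at hrel
  -- `P([p]˜ X) = p • P(X)` and `−P(σ) = P(ĩ σ)`
  have hmul : (V.map PadicInt.toZMod).laurentPt ((V.map PadicInt.toZMod).formalMul p) hn0 =
      (p : ℤ) • (V.map PadicInt.toZMod).laurentPt (PowerSeries.X : (ZMod p)⟦X⟧) hX := by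
    rw [natCast_zsmul, ← laurentPt_formalMul' V PadicInt.toZMod p hX]
    exact laurentPt_congr (X_subst _).symm _ _
  have hneg := (V.map PadicInt.toZMod).neg_laurentPt hn0
  refine laurentPt_injective (E := V.map PadicInt.toZMod) hin0 hXp2 ?_
  rw [← hneg, hmul, eq_comm, ← sub_eq_zero, sub_neg_eq_add]
  exact hrel

/-- **`f_V = i_V([p]_V X) ∈ 𝔉_{−p}` for `q = p²`** (`tr(V mod p) = 0`): `f_V ≡ −pX (mod deg 2)` and `f_V ≡ X^{p²} (mod p)` —
a Lubin–Tate series for the uniformiser `−p` of `ℤ_p` and the exponent `q = p²` of the RELATIVE Lubin–Tate theory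
(de Shalit I §1.1; Kobayashi Prop. 8.6 «the Lubin–Tate formal group of height two with the parameter −p»).
[cite: Kobayashi2003, Prop. 8.6] [cite: LubinTate1965, §1] -/
theorem isLTSeries_formalNeg_subst_formalMul
    (htr : Literature.NumberTheory.EllipticCurves.HasseManin.tr (V.map PadicInt.toZMod) = 0) :
    LubinTate.IsLTSeries (-(p : ℤ_[p])) (p ^ 2) (V.formalNeg.subst (V.formalMul p)) := by
  refine ⟨constantCoeff_formalNeg_subst_formalMul V p, coeff_one_formalNeg_subst_formalMul V p, fun n ↦ ?_⟩
  rw [neg_dvd, ← Ideal.mem_span_singleton, ← PadicInt.maximalIdeal_eq_span_p, ← PadicInt.ker_toZMod,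
    RingHom.mem_ker, map_sub]
  have h := congrArg (coeff n) (map_toZMod_formalNeg_subst_formalMul V htr)
  rw [coeff_map, coeff_X_pow] at h
  rw [h]
  split_ifs <;> simp

omit hE hEt in
/-- **`ℤ_p` is a Lubin–Tate base for `(π, q) = (−p, p²)`**: `−p` is regular, `1 − (−p)^m` is a unit for `m ≥ 1`,
`p ∈ (−p)`, and `a^{p²} ≡ a (mod p)` for all `a ∈ ℤ_p` (Fermat twice). The residue field is `𝔽_p`, NOT `𝔽_{p²}`: this is
the relative situation `q ≠ #k` (de Shalit I §1.1), which the tree's abstract `IsLTRing` allows.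
[cite: LubinTate1965, §1] [cite: deShalit1987, Ch. I §1.1] -/
theorem isLTRing_padicInt : LubinTate.IsLTRing (-(p : ℤ_[p])) (p ^ 2) := by
  have hp0 : (p : ℤ_[p]) ≠ 0 := by exact_mod_cast hp.out.ne_zero
  refine ⟨fun x hx ↦ ?_, fun m hm ↦ ?_, ⟨p, 2, hp.out, rfl, ?_⟩, fun a ↦ ?_⟩
  · rcases mul_eq_zero.mp hx with h | h
    · exact absurd (neg_eq_zero.mp h) hp0
    · exact h
  · apply IsLocalRing.isUnit_one_sub_self_of_mem_nonunits
    rw [PadicInt.mem_nonunits, norm_pow, norm_neg, PadicInt.norm_p]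
    exact pow_lt_one₀ (by positivity) (inv_lt_one_of_one_lt₀ (by exact_mod_cast hp.out.one_lt)) hm.ne'
  · exact Ideal.mem_span_singleton.mpr ⟨-1, by ring⟩
  · rw [neg_dvd, ← Ideal.mem_span_singleton, ← PadicInt.maximalIdeal_eq_span_p, ← PadicInt.ker_toZMod,
      RingHom.mem_ker, map_sub, map_pow, sq, pow_mul, ZMod.pow_card, ZMod.pow_card, sub_self]

end PadicInt

/-! ## §2b Base change of the Lubin–Tate data to a `ℤ_p`-algebra `A` -/

section BaseChange

/-- A Lubin–Tate series stays Lubin–Tate under any ring map (`π ↦ φ π`, same `q`). [cite: LubinTate1965, §1] -/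
theorem isLTSeries_map {R S : Type*} [CommRing R] [CommRing S] (φ : R →+* S) {π : R} {q : ℕ} {f : R⟦X⟧}
    (hf : LubinTate.IsLTSeries π q f) : LubinTate.IsLTSeries (φ π) q (PowerSeries.map φ f) := by
  refine ⟨?_, ?_, fun n ↦ ?_⟩
  · rw [← coeff_zero_eq_constantCoeff_apply, coeff_map, coeff_zero_eq_constantCoeff_apply, hf.constantCoeff_eq_zero,
      map_zero]
  · rw [coeff_map, hf.coeff_one]
  · rw [coeff_map]
    have h := map_dvd φ (hf.dvd_coeff_sub n)
    rw [map_sub] at h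
    convert h using 2
    split_ifs <;> simp

/-- **Lubin–Tate bases for `(−p, p²)` beyond `ℤ_p`**: a local ring `A` in which `p ∈ 𝔪_A` is regular and
`a^{p²} ≡ a (mod p)` for every `a` — e.g. the Witt vectors `W(𝔽_{p²})` (`ℤ₄` at `p = 2`), or any `𝒪_K`, `K/ℚ_p` finite
with residue degree dividing `2`. [cite: CasselsFrohlichANT1967, Ch. VI §3.5 Prop. 5, Remark 2] -/
theorem isLTRing_of_isLocalRing (p : ℕ) [hp : Fact p.Prime] {A : Type*} [CommRing A] [IsLocalRing A]
    (hmax : (p : A) ∈ IsLocalRing.maximalIdeal A) (hreg : ∀ x : A, (p : A) * x = 0 → x = 0)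
    (hfrob : ∀ a : A, (p : A) ∣ a ^ (p ^ 2) - a) : LubinTate.IsLTRing (-(p : A)) (p ^ 2) := by
  refine ⟨fun x hx ↦ hreg x ?_, fun m hm ↦ ?_, ⟨p, 2, hp.out, rfl, ?_⟩, fun a ↦ neg_dvd.mpr (hfrob a)⟩
  · rw [neg_mul] at hx
    exact neg_eq_zero.mp hx
  · apply IsLocalRing.isUnit_one_sub_self_of_mem_nonunits
    rw [← IsLocalRing.mem_maximalIdeal]
    exact Ideal.pow_mem_of_mem _ ((IsLocalRing.maximalIdeal A).neg_mem hmax) m hm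
  · exact Ideal.mem_span_singleton.mpr ⟨-1, by ring⟩

end BaseChange

end Summit.BirchSwinnertonDyer.BirchSwinnertonDyer.Theorems.RelativeLubinTate

end
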